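import Mathlib.RingTheory.DedekindDomain.Factorization
import Mathlib.RingTheory.Localization.Ideal
import Mathlib.Data.Set.Card
import HarnessLib

/-!
# The finitely many maximal ideals of a Dedekind domain containing a given element

Elementary bookkeeping used by the gluing step of Néron's existence theorem
(`Literature.NumberTheory.EllipticCurves.NeronModelGluing`): for `f ≠ 0` in a Dedekind domain
`R`, the set `maximalIdealsContaining R f = {𝔭 maximal : f ∈ 𝔭}` (the prime factors of `(f)`, the closed
points of `V(f) ⊆ Spec R`) is finite; under localization away from `x` contraction of ideals maps
the bad primes of `f` in `R[1/x]` injectively to the bad primes of `f` in `R` not containing `x`;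
and a finite set of maximal ideals can be split comaximally off one of its members
(`exists_add_eq_one_of_finite`: `g + h = 1` with `g ∉ 𝔭₁`, `h ∈ 𝔭₁`, `g ∈ 𝔮` for all other `𝔮`).
All of this is standard commutative algebra (Atiyah–Macdonald, Prop. 1.11 (prime avoidance),
Ch. 9 (Dedekind domains)); the proofs are from Mathlib's `Ideal.finite_factors`,
`Ideal.IsPrime.inf_le'`, `Ideal.IsMaximal.exists_inv`, `IsLocalization.map_under`.
-/

namespace Literature.RingTheory.DedekindDomain

universe u

variable {R : Type u} [CommRing R]

variable (R) in
/-- `maximalIdealsContaining R f`: the maximal ideals of `R` containing `f` (for a Dedekind domain and `f ≠ 0`,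
the closed points of `V(f) ⊆ Spec R`, i.e. the prime factors of `(f)`). [folklore] -/
def maximalIdealsContaining (f : R) : Set (Ideal R) := {p | p.IsMaximal ∧ f ∈ p}

/-- Membership in `maximalIdealsContaining` (definitional unfolding). [folklore] -/
theorem mem_maximalIdealsContaining {f : R} {p : Ideal R} : p ∈ maximalIdealsContaining R f ↔ p.IsMaximal ∧ f ∈ p :=
  Iff.rfl

open IsDedekindDomain in
/-- In a Dedekind domain only finitely many maximal ideals contain a given `f ≠ 0`
(Mathlib `Ideal.finite_factors`). [folklore] -/
theorem finite_maximalIdealsContaining [IsDedekindDomain R] {f : R} (hf : f ≠ 0) : (maximalIdealsContaining R f).Finite := by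
  have hI : Ideal.span {f} ≠ ⊥ := by simpa [Ideal.span_singleton_eq_bot] using hf
  refine ((Ideal.finite_factors hI).image HeightOneSpectrum.asIdeal).subset ?_
  rintro p ⟨hp, hfp⟩
  have hp0 : p ≠ ⊥ := fun h => hf (by simpa [h] using hfp)
  exact ⟨⟨p, hp.isPrime, hp0⟩, Ideal.dvd_span_singleton.mpr hfp, rfl⟩

/-- If no maximal ideal contains `f`, then `f` is a unit. [folklore] -/
theorem isUnit_of_maximalIdealsContaining_eq_empty {f : R} (hempty : maximalIdealsContaining R f = ∅) : IsUnit f := by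
  by_contra hu
  obtain ⟨m, hm, hfm⟩ := Ideal.exists_le_maximal (Ideal.span {f})
    (fun h => hu (Ideal.span_singleton_eq_top.mp h))
  have : m ∈ maximalIdealsContaining R f := ⟨hm, hfm (Ideal.subset_span rfl)⟩
  rw [hempty] at this
  exact this

/-- Under localization away from `x`, contraction sends the maximal ideals of `R''` containing
`f` to maximal ideals of `R` containing `f` and not containing `x` (`R` Dedekind, `f ≠ 0`). [folklore] -/
theorem comap_mem_maximalIdealsContaining [IsDedekindDomain R] {f : R} (hf : f ≠ 0) (x : R) (R'' : Type*)
    [CommRing R''] [Algebra R R''] [IsLocalization.Away x R''] (Q : Ideal R'')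
    (hQ : Q ∈ maximalIdealsContaining R'' (algebraMap R R'' f)) :
    Q.comap (algebraMap R R'') ∈ maximalIdealsContaining R f ∧ x ∉ Q.comap (algebraMap R R'') := by
  obtain ⟨hQmax, hfQ⟩ := hQ
  have hfq : f ∈ Q.comap (algebraMap R R'') := Ideal.mem_comap.mpr hfQ
  refine ⟨⟨Ideal.IsPrime.isMaximal inferInstance fun h => hf (by simpa [h] using hfq), hfq⟩, ?_⟩
  intro hx
  apply hQmax.ne_top
  exact Ideal.eq_top_of_isUnit_mem _ (Ideal.mem_comap.mp hx)
    (IsLocalization.Away.algebraMap_isUnit x)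

/-- If `x` lies in some bad prime `𝔭₁` of `f`, then a model `R''` of `R[1/x]` has at most
`#maximalIdealsContaining R f - 1` bad primes for `f`: contraction is injective on the ideals of a localization
(Mathlib `IsLocalization.map_under`) and misses `𝔭₁`. [folklore] -/
theorem ncard_maximalIdealsContaining_localization_le [IsDedekindDomain R] {f : R} (hf : f ≠ 0) (x : R)
    (R'' : Type*) [CommRing R''] [Algebra R R''] [IsLocalization.Away x R''] {p₁ : Ideal R}
    (hp₁ : p₁ ∈ maximalIdealsContaining R f) (hx : x ∈ p₁) :
    (maximalIdealsContaining R'' (algebraMap R R'' f)).ncard ≤ (maximalIdealsContaining R f).ncard - 1 := by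
  have hmaps : Set.MapsTo (fun Q : Ideal R'' => Q.comap (algebraMap R R''))
      (maximalIdealsContaining R'' (algebraMap R R'' f)) (maximalIdealsContaining R f \ {p₁}) := by
    intro Q hQ
    obtain ⟨h₁, h₂⟩ := comap_mem_maximalIdealsContaining hf x R'' Q hQ
    refine ⟨h₁, ?_⟩
    rintro (rfl : Q.comap (algebraMap R R'') = p₁)
    exact h₂ hx
  have hinj : Set.InjOn (fun Q : Ideal R'' => Q.comap (algebraMap R R''))
      (maximalIdealsContaining R'' (algebraMap R R'' f)) := by
    intro Q₁ _ Q₂ _ h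
    have h' := congrArg (Ideal.map (algebraMap R R'')) h
    simpa only [IsLocalization.map_under (Submonoid.powers x) R''] using h'
  calc (maximalIdealsContaining R'' (algebraMap R R'' f)).ncard
      ≤ (maximalIdealsContaining R f \ {p₁}).ncard :=
        Set.ncard_le_ncard_of_injOn _ hmaps hinj ((finite_maximalIdealsContaining hf).sdiff)
    _ = (maximalIdealsContaining R f).ncard - 1 := Set.ncard_sdiff_singleton_of_mem hp₁

/-- Under localization away from `g ∉ 𝔭₁`, if every bad prime of `f` other than `𝔭₁` contains
`g`, then `𝔭₁ R''` is the only maximal ideal of `R''` containing `f` (`R` Dedekind, `f ≠ 0`). [folklore] -/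
theorem eq_map_of_mem_maximalIdealsContaining_localization [IsDedekindDomain R] {f : R} (hf : f ≠ 0) (g : R)
    (R'' : Type*) [CommRing R''] [Algebra R R''] [IsLocalization.Away g R''] {p₁ : Ideal R}
    (hgq : ∀ q ∈ maximalIdealsContaining R f, q ≠ p₁ → g ∈ q) (Q : Ideal R'')
    (hQ : Q ∈ maximalIdealsContaining R'' (algebraMap R R'' f)) : Q = p₁.map (algebraMap R R'') := by
  obtain ⟨hcQ, hgQ⟩ := comap_mem_maximalIdealsContaining hf g R'' Q hQ
  have hc : Q.comap (algebraMap R R'') = p₁ := by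
    by_contra hne
    exact hgQ (hgq _ hcQ hne)
  rw [← IsLocalization.map_under (Submonoid.powers g) R'' Q]
  exact congrArg (Ideal.map (algebraMap R R'')) hc

/-- **Comaximal splitting off one maximal ideal.** For a finite set `B` of maximal ideals and
`𝔭₁ ∈ B` there are `g + h = 1` with `g ∉ 𝔭₁`, `h ∈ 𝔭₁` and `g ∈ 𝔮` for every other `𝔮 ∈ B`:
prime avoidance (`⋂_{𝔮 ≠ 𝔭₁} 𝔮 ⊄ 𝔭₁`, Mathlib `Ideal.IsPrime.inf_le'`) gives `g₀`, and
`𝔭₁ + (g₀) = R` (`Ideal.IsMaximal.exists_inv`) gives `y g₀ + h = 1`; put `g = y g₀`. [folklore] -/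
theorem exists_add_eq_one_of_finite {B : Set (Ideal R)} (hB : B.Finite)
    (hmax : ∀ q ∈ B, q.IsMaximal) {p₁ : Ideal R} (hp₁ : p₁ ∈ B) :
    ∃ g h : R, g + h = 1 ∧ g ∉ p₁ ∧ h ∈ p₁ ∧ ∀ q ∈ B, q ≠ p₁ → g ∈ q := by
  classical
  let s : Finset (Ideal R) := hB.toFinset.erase p₁
  have hs : ∀ q, q ∈ s ↔ q ≠ p₁ ∧ q ∈ B := fun q => by simp [s]
  have hp₁max := hmax p₁ hp₁
  have hnot : ¬ s.inf id ≤ p₁ := by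
    rw [hp₁max.isPrime.inf_le']
    rintro ⟨q, hq, hle⟩
    obtain ⟨hne, hqB⟩ := (hs q).mp hq
    exact hne ((hmax q hqB).eq_of_le hp₁max.ne_top hle)
  obtain ⟨g₀, hg₀, hg₀p⟩ := SetLike.not_le_iff_exists.mp hnot
  obtain ⟨y, i, hi, hyi⟩ := hp₁max.exists_inv hg₀p
  refine ⟨y * g₀, i, hyi, ?_, hi, ?_⟩
  · intro hmem
    apply hp₁max.ne_top
    rw [Ideal.eq_top_iff_one, ← hyi]
    exact p₁.add_mem hmem hi
  · intro q hqB hne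
    exact q.mul_mem_left y ((Submodule.mem_finsetInf).mp hg₀ q ((hs q).mpr ⟨hne, hqB⟩))

/-- `g + h = 1` implies `(g, h) = R`. [folklore] -/
theorem span_pair_eq_top_of_add_eq_one {g h : R} (hgh : g + h = 1) : Ideal.span {g, h} = ⊤ := by
  rw [Ideal.eq_top_iff_one, ← hgh]
  exact Ideal.add_mem _ (Ideal.subset_span (by simp)) (Ideal.subset_span (by simp))

end Literature.RingTheory.DedekindDomain
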